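import Summits.QuantumFields.YangMills.Theorems.AlphaInputsT3ACv3StepLowPrintOrbitOfUniqueMin
import Literature.MathematicalPhysics.QuantumFieldTheory.Balaban1983to89.T3Thm1UniquenessSchema
import HarnessLib

/-!
# `AlphaInputsT3ACv3StepLowPrintOrbitOfThm1Unique` — THE r1′ LETTER OF (α)-ROW #23 READ FROM THE NAMED LITERATURE SCHEMAS `Thm1UniqueMinOrbitAt` ∕ `Prop7AtMostOneCriticalOrbitAt`,
# WITH THEIR EDGES FROM LQB's PRINTED STATEMENTS (cell `ym3-torus`, (α)-row #23 `fibre57LowOn` at print's family; seat `ym3-torus-px20` g14, width copy of p1; sequel of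
# ✓`AlphaInputsT3ACv3StepLowPrintOrbitOfUniqueMin` and of lit ✓`T3Thm1UniquenessSchema`; `--supports stmt-QuantumFields-19936 --as helper`)

WHAT.  ✓`…PrintOrbitOfUniqueMin` discharged the orbit-covariance letter `hcov` of the lower row at print's family from row r1 + the displayed binder `huniq` ([Balaban1985Variational]
Thm 1 sentence 2 at the record's carriers and constants).  Lit ✓`T3Thm1UniquenessSchema` names that text at the `L`-level, next to `T3PrintedMinimiserExistence.Thm1GlobalMinAt`:
`Thm1UniqueMinOrbitAt L a₀ a₁ B₃` (Thm 1 sentence 2, MINIMISER reading R2) and `Prop7AtMostOneCriticalOrbitAt L a₀ B₃` (Prop. 7 clause 1) — a statement-only file.  THIS FILE: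
* §1 THE EDGES of the schemas (bookkeeping, proved): `thm1UniqueMinOrbitAt_iff_unique6` (⟺ `B11Thm1.Unique6` over the family `T3Thm1Carrier.fam L`, two tokens each way);
  `thm1UniqueMinOrbitAt_mono` ∕ `prop7AtMostOneCriticalOrbitAt_mono` (antitone in `a₀`, `a₁`); ★ `thm1UniqueMinOrbitAt_of_thm1At` (⟸ `B11Thm1.Thm1At C` at every carrier — the sibling of
  lit ✓`T3Thm1Carrier.thm1MinimalIn8At_of_thm1At`, so ONE Thm-1-at-constants hypothesis over `fam L` feeds BOTH r1's `Thm1MinimalIn8At` and r1′); ★ `thm1UniqueMinOrbitAt_of_prop7`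
  (⟸ Prop. 7 clause 1, every `a₁`, `B₃ > 0`: (8) ⊆ (6) + reading-R2 criticality of both minimisers); `prop7AtMostOneCriticalOrbitAt_of_prop7Printed` (⟸ LQB `B11.Prop7Printed B₃ C₁ (famX L)`);
  `prop7AtMostOneCriticalOrbitAt_iff_famX` (the 19200 lane's `Idx`∕`famX` binder shape, for a 19200-side «EX⁺» cite).
* §2 AT THE RECORD: `PkgCoreRows.huniq_of_thm1UniqueMinOrbitAt` (the displayed `huniq` of ✓`hcov_of_uniqueMinOrbit` ⟸ `Thm1UniqueMinOrbitAt F.L q.a₀ q.a₁ 𝔠.B₃`, one member);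
  ★★ `hcov_of_thm1UniqueMinOrbitAt` ∕ `hcov_of_prop7AtMostOneCriticalOrbitAt`; ★ `fibre57LowOnAC_T3_loPrintAC_of_le_gamma_of_thm1UniqueMinOrbitAt` = ✓p777817 ★ with `huniq ↦ (hT : Thm1UniqueMinOrbitAt F.L q.a₀ q.a₁ 𝔠.B₃)`.
So the r1′ antecedent of (α)-row #23 at print's family is citable in EITHER registry shape of ★★OWNER g36's r1′ census line (15:33:39Z): (i) «`Thm1UniqueMinOrbitAt L a₀ a₁ B →`» next to
`Thm1GlobalMinAt L a₀ a₁ B →`, or (ii) a 19200-side «EX⁺» citing `Prop7AtMostOneCriticalOrbitAt` — two tokens either way.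

HONEST SCOPE.  [folklore] bookkeeping; def-free; the schemas are HYPOTHESES (never asserted; print's proof = [Balaban1985Variational] Sect. E); nothing of #23's pins, `hdom`, (47)∕(57), the
(α) data rows (0∕23), (O‴χₛ), `HistoryTailL` (19936), EX, LOWB∘ or `YM3TorusSU2` is proved (rung R3 = SU(2) YM₃ on T³, a RECORD rung: NOT d = 4, NOT infinite volume, NOT a mass gap,
NOT Clay; the Yang–Mills mass gap is NOT proved).  L-floor: none.
References: T. Bałaban, Commun. Math. Phys. **102** (1985) 277–309 [Balaban1985Variational] ((4)–(8) p.278, Thm 1 p.279, Prop. 7 p.299, (181) p.307); **102** (1985) 255–275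
[Balaban1985UV3] ((47) p.267, p.272 L32–33); **109** (1987) 249–301 [Balaban1987RG1] ((0.21) p.256).
-/

set_option autoImplicit false

noncomputable section

namespace Summit.QuantumFields.YangMills.Theorems

open MeasureTheory Literature.MathematicalPhysics.QuantumFieldTheory.Balaban1983to89
open Literature.MathematicalPhysics.QuantumFieldTheory.Balaban1983to89.GaugeField (GaugeInvariant gaugeAct)
open Literature.MathematicalPhysics.QuantumFieldTheory.Balaban1983to89.BlockAveraging (avgFun loopHol Idx)
open Literature.MathematicalPhysics.QuantumFieldTheory.Balaban1983to89.ExpMeanLog (expMeanLogSU)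
open Literature.MathematicalPhysics.QuantumFieldTheory.Balaban1983to89.T3ContinuumYM3Torus
open Literature.MathematicalPhysics.QuantumFieldTheory.Balaban1983to89.T3UnitScaleTilt (θBal)
open Literature.MathematicalPhysics.QuantumFieldTheory.Balaban1983to89.T3PrintedRegularMinimiser (regFibrePr mem_regFibrePr_iff)
open Literature.MathematicalPhysics.QuantumFieldTheory.Balaban1983to89.T3PrintedMinimiserExistence (regFibrePr_mono Thm1MinimalIn8At)
open Literature.MathematicalPhysics.QuantumFieldTheory.Balaban1983to89.T3Thm1Carrier (varProblem3 fam famX)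
open Literature.MathematicalPhysics.QuantumFieldTheory.Balaban1983to89.T3Thm1UniquenessSchema (Thm1UniqueMinOrbitAt Prop7AtMostOneCriticalOrbitAt)
open Literature.MathematicalPhysics.QuantumFieldTheory.Balaban1983to89.B11 (Prop7Printed)
open Literature.MathematicalPhysics.QuantumFieldTheory.Balaban1983to89.B11Thm1 (Unique6 Thm1At)
open Literature.MathematicalPhysics.QuantumFieldTheory.Balaban1985CMP102 Literature.MathematicalPhysics.QuantumFieldTheory.Balaban1985CMP102.Setting
open Summit.QuantumFields.Balaban3D.Carriers
open Summit.QuantumFields.Balaban3D.Proofs.Primitives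
open Summit.QuantumFields.Balaban3D.Proofs.Thresholds (Q0 Q0_pos)
open Summit.QuantumFields.Balaban3D.Proofs.TowerAC Summit.QuantumFields.Balaban3D.Proofs.StandardAC Summit.QuantumFields.Balaban3D.Proofs.InputsAC
open Summit.QuantumFields.Balaban3D.Proofs.Bound55Masses (chiB)
open Summit.QuantumFields.Balaban3D.Proofs.GaussianNormalization (partZ normalized)
open Summit.QuantumFields.YangMills.Theorems.PinnedStep (Fibre57LowOnAC)
open scoped NNReal ENNReal

/-! ## §1 The edges of the `L`-level schemas from LQB's printed statements at the carriers -/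

namespace AlphaInputsT3AC

variable {L : ℕ} {a₀ a₁ B₃ : ℝ}

/-- **`Thm1UniqueMinOrbitAt` IS `B11Thm1.Unique6` OVER THE FAMILY OF CARRIERS** (LQB's typing of Thm 1's second sentence, its `∀ ε₀` after `V`; two tokens each way).
[cite: Balaban1985Variational, Thm 1 (8) p.279] -/
theorem thm1UniqueMinOrbitAt_iff_unique6 :
    Thm1UniqueMinOrbitAt L a₀ a₁ B₃ ↔
      ∀ (i : T3Thm1Carrier.Idx L) (ε₁ : ℝ), 0 < ε₁ → ε₁ ≤ a₁ → ∀ V : (fam L i).Bdry, (fam L i).Reg7 ε₁ V → Unique6 (fam L i) a₀ B₃ ε₁ V := by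
  constructor
  · intro h i ε₁ hε₁ hε₁a V hV ε₀ hlo hhi U hU
    obtain ⟨⟨F, n, K⟩, hF, hnK⟩ := i
    exact h F hF n K hnK ε₁ ε₀ hε₁ hε₁a hlo hhi V hV U hU
  · intro h F hF n K hnK ε₁ ε₀ hε₁ hε₁a hlo hhi V hV U hU
    exact h ⟨(F, n, K), hF, hnK⟩ ε₁ hε₁ hε₁a V hV ε₀ hlo hhi U hU

/-- Monotonicity: `Thm1UniqueMinOrbitAt` is antitone in `a₀` and in `a₁`. [cite: Balaban1985Variational, Thm 1 p.279] -/
theorem thm1UniqueMinOrbitAt_mono {a₀' a₁' : ℝ} (h : Thm1UniqueMinOrbitAt L a₀ a₁ B₃) (ha₀ : a₀' ≤ a₀) (ha₁ : a₁' ≤ a₁) :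
    Thm1UniqueMinOrbitAt L a₀' a₁' B₃ :=
  fun F hF n K hnK ε₁ ε₀ hε₁ hε₁a hlo hhi V hV U hU => h F hF n K hnK ε₁ ε₀ hε₁ (hε₁a.trans ha₁) hlo (hhi.trans ha₀) V hV U hU

/-- Monotonicity: `Prop7AtMostOneCriticalOrbitAt` is antitone in `a₀`. [cite: Balaban1985Variational, Prop. 7 p.299] -/
theorem prop7AtMostOneCriticalOrbitAt_mono {a₀' : ℝ} (h : Prop7AtMostOneCriticalOrbitAt L a₀ B₃) (ha₀ : a₀' ≤ a₀) :
    Prop7AtMostOneCriticalOrbitAt L a₀' B₃ :=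
  fun F hF n K hnK ε₁ ε₀ hε₁ hlo hhi V hV => h F hF n K hnK ε₁ ε₀ hε₁ hlo (hhi.trans ha₀) V hV

/-- ★ **EDGE — `Thm1UniqueMinOrbitAt` ⇐ [7] THM 1 AT GIVEN CONSTANTS OVER THE FAMILY** (the second conjunct of `B11Thm1.Thm1At` at every carrier `fam L i`; sibling of
lit ✓`T3Thm1Carrier.thm1MinimalIn8At_of_thm1At`). [cite: Balaban1985Variational, Thm 1 (8) p.279] -/
theorem thm1UniqueMinOrbitAt_of_thm1At (C : B11Thm1.Consts) (H : ∀ i : T3Thm1Carrier.Idx L, Thm1At C (fam L i)) : Thm1UniqueMinOrbitAt L C.a₀ C.a₁ C.B₃ := by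
  refine thm1UniqueMinOrbitAt_iff_unique6.mpr fun i ε₁ hε₁ hε₁a V hV => ?_
  obtain ⟨-, huniq, -⟩ := H i ε₁ hε₁ hε₁a V hV
  exact huniq

/-- **BOTH CLAUSES OF THM 1 FROM ONE HYPOTHESIS**: Thm 1 at given constants over the family gives existence (`Thm1MinimalIn8At`, lit ✓`thm1MinimalIn8At_of_thm1At`) AND uniqueness
(`Thm1UniqueMinOrbitAt`) at the SAME constants — the pair a registry row «`Thm1GlobalMinAt … →` ∧ `Thm1UniqueMinOrbitAt … →`» asks of one supplier. [cite: Balaban1985Variational, Thm 1 (8) p.279] -/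
theorem thm1MinimalIn8At_and_uniqueMinOrbitAt_of_thm1At (C : B11Thm1.Consts) (H : ∀ i : T3Thm1Carrier.Idx L, Thm1At C (fam L i)) :
    Thm1MinimalIn8At L C.a₁ C.B₃ ∧ Thm1UniqueMinOrbitAt L C.a₀ C.a₁ C.B₃ :=
  ⟨T3Thm1Carrier.thm1MinimalIn8At_of_thm1At C H, thm1UniqueMinOrbitAt_of_thm1At C H⟩

/-- ★ **EDGE — `Thm1UniqueMinOrbitAt` ⇐ PROP. 7's CLAUSE 1**, for every `a₁` (`B₃ > 0`): a configuration on a minimal orbit of (5) in (8) is critical in reading R2 at radius `B₃ε₁ > 0`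
and lies in (6)(ε₀) ((8) ⊆ (6), `regFibrePr_mono`); a minimiser of (5) over (6)(ε₀) is critical in reading R2 at radius `ε₀ ≥ B₃ε₁ > 0`; clause 1 puts the two on one orbit of (4)
(print p.299: «This proposition implies Theorem 1 but with worse bounds»). [cite: Balaban1985Variational, Prop. 7 p.299 + Thm 1 (8) p.279] -/
theorem thm1UniqueMinOrbitAt_of_prop7 (hB₃ : 0 < B₃) (h7 : Prop7AtMostOneCriticalOrbitAt L a₀ B₃) (a₁ : ℝ) :
    Thm1UniqueMinOrbitAt L a₀ a₁ B₃ := by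
  intro F hF n K hnK ε₁ ε₀ hε₁ _ hlo hhi V hV U hU
  obtain ⟨hU8, hmin8⟩ := hU
  have he : 0 < B₃ * ε₁ := mul_pos hB₃ hε₁
  have hU6 : U ∈ regFibrePr F n K hnK.le ε₀ V := regFibrePr_mono F hlo V hU8
  refine ⟨hU6, fun U' hU' hmin' => ?_⟩
  exact h7 F hF n K hnK ε₁ ε₀ hε₁ hlo hhi V hV U U' ((mem_regFibrePr_iff F).mp hU6).2 ((mem_regFibrePr_iff F).mp hU6).1 ⟨B₃ * ε₁, he, hU8, hmin8⟩
    ((mem_regFibrePr_iff F).mp hU').2 ((mem_regFibrePr_iff F).mp hU').1 ⟨ε₀, he.trans_le hlo, hU', hmin'⟩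

/-- **EDGE — `Prop7AtMostOneCriticalOrbitAt` ⇐ LQB's `B11.Prop7Printed` OVER THE FAMILY `famX L`** (its clause 1, the constant `a₀` extracted; `C₁` and clause 2 unused).
[cite: Balaban1985Variational, Prop. 7 p.299] -/
theorem prop7AtMostOneCriticalOrbitAt_of_prop7Printed {C₁ : ℝ} (H : Prop7Printed B₃ C₁ (famX L)) :
    ∃ a₀ : ℝ, 0 < a₀ ∧ Prop7AtMostOneCriticalOrbitAt L a₀ B₃ := by
  obtain ⟨a₀, a₁', O₁, ha₀, -, -, H⟩ := H
  refine ⟨a₀, ha₀, fun F hF n K hnK ε₁ ε₀ hε₁ hlo hhi V hV => ?_⟩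
  exact (H ⟨(F, n, K), hF, hnK⟩ ε₀ ε₁ hε₁ V hV).1 hhi hlo

/-- **`Prop7AtMostOneCriticalOrbitAt` IN THE 19200 LANE's `Idx`∕`famX` VOCABULARY** (the binder shape of `B11.Prop7Printed` clause 1 and of ✓`Prop7OrbitTransport.prop7From14_pureGaugeDatum`,
constant outside): the reading a 19200-side item «EX⁺» would cite. [cite: Balaban1985Variational, Prop. 7 p.299] -/
theorem prop7AtMostOneCriticalOrbitAt_iff_famX :
    Prop7AtMostOneCriticalOrbitAt L a₀ B₃ ↔
      ∀ (i : T3Thm1Carrier.Idx L) (ε₀ ε₁ : ℝ), 0 < ε₁ → ∀ V : (famX L i).Bdry, (famX L i).Reg7 ε₁ V →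
        ε₀ ≤ a₀ → B₃ * ε₁ ≤ ε₀ → (famX L i).AtMostOneCriticalOrbit ε₀ V := by
  constructor
  · intro h i ε₀ ε₁ hε₁ V hV hhi hlo
    obtain ⟨⟨F, n, K⟩, hF, hnK⟩ := i
    exact h F hF n K hnK ε₁ ε₀ hε₁ hlo hhi V hV
  · intro h F hF n K hnK ε₁ ε₀ hε₁ hlo hhi V hV
    exact h ⟨(F, n, K), hF, hnK⟩ ε₀ ε₁ hε₁ V hV hhi hlo

end AlphaInputsT3AC

/-! ## §2 At the T³ rows record: the displayed `huniq` ∕ the letter `hcov` ∕ the lower row from the named schemas -/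

namespace AlphaInputsT3AC.PkgCoreRows

variable {F : T3Family} {𝔠 : AlphaConsts F.L (suGroupModel 2).N} {γ : ℝ} {hγ : 0 < γ} {hγ1 : γ ≤ (min 𝔠.gamma0 1) ^ 2} {K : ℕ}
  (q : AlphaInputsT3AC.PkgCoreRows F 𝔠 γ hγ hγ1 K)

/-- **THE DISPLAYED `huniq` OF ✓`hcov_of_uniqueMinOrbit` FROM THE NAMED SCHEMA** at the record's own member and constants (`F`, `q.a₀`, `q.a₁`, `𝔠.B₃`; one token `rfl`).
[cite: Balaban1985Variational, Thm 1 (8) p.279] -/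
theorem huniq_of_thm1UniqueMinOrbitAt (hT : Thm1UniqueMinOrbitAt F.L q.a₀ q.a₁ 𝔠.B₃) :
    ∀ (n : ℕ) (hnK : n < K) (ε₁ ε₀ : ℝ), 0 < ε₁ → ε₁ ≤ q.a₁ → 𝔠.B₃ * ε₁ ≤ ε₀ → ε₀ ≤ q.a₀ →
      ∀ V : GaugeField (F.P n) 0 (Matrix.specialUnitaryGroup (Fin 2) ℂ), PlaqSmall ε₁ V →
        ∀ U : GaugeField (F.P K) 0 (Matrix.specialUnitaryGroup (Fin 2) ℂ),
          (varProblem3 F n K hnK.le).OnMinimalOrbit (𝔠.B₃ * ε₁) V U → (varProblem3 F n K hnK.le).UniqueCriticalOrbit ε₀ V U :=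
  fun n hnK => hT F rfl n K hnK

/-- ★★ **`hcov` FROM ROW r1 + `Thm1UniqueMinOrbitAt F.L q.a₀ q.a₁ 𝔠.B₃`** (✓`hcov_of_uniqueMinOrbit` with `huniq` read from the named schema), every `k ≤ K`.
[cite: Balaban1985Variational, Thm 1 (8) p.279 + (181) p.307; Balaban1985UV3, (47) p.267] -/
theorem hcov_of_thm1UniqueMinOrbitAt (ha₁ : ∀ i, θBal F.L γ 𝔠.b₀ 𝔠.p₀ i ≤ q.a₁) (hT : Thm1UniqueMinOrbitAt F.L q.a₀ q.a₁ 𝔠.B₃) (k : ℕ) (hk : k ≤ K) :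
    ∀ (u : GaugeTransf (F.P K) k (Matrix.specialUnitaryGroup (Fin 2) ℂ)) (V : GaugeField (F.P K) k (Matrix.specialUnitaryGroup (Fin 2) ℂ)),
      PlaqSmall (eps1Of (T3Scales F γ hγ (hγ1.trans (sq_min_one_le _ 𝔠.gamma0_pos)) K) 𝔠.lane.carrier k) V →
        ∃ w : GaugeTransf (F.P K) 0 (Matrix.specialUnitaryGroup (Fin 2) ℂ), ukAll q.X.Uk k (gaugeAct u V) = gaugeAct w (ukAll q.X.Uk k V) :=
  q.hcov_of_uniqueMinOrbit ha₁ (q.huniq_of_thm1UniqueMinOrbitAt hT) k hk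

/-- ★★ **`hcov` FROM ROW r1 + PROP. 7's CLAUSE 1 `Prop7AtMostOneCriticalOrbitAt F.L q.a₀ 𝔠.B₃`** (§1 `thm1UniqueMinOrbitAt_of_prop7` at `a₁ := q.a₁`, `0 < 𝔠.B₃`), every `k ≤ K`.
[cite: Balaban1985Variational, Prop. 7 p.299 + (181) p.307; Balaban1985UV3, (47) p.267] -/
theorem hcov_of_prop7AtMostOneCriticalOrbitAt (ha₁ : ∀ i, θBal F.L γ 𝔠.b₀ 𝔠.p₀ i ≤ q.a₁) (h7 : Prop7AtMostOneCriticalOrbitAt F.L q.a₀ 𝔠.B₃) (k : ℕ) (hk : k ≤ K) :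
    ∀ (u : GaugeTransf (F.P K) k (Matrix.specialUnitaryGroup (Fin 2) ℂ)) (V : GaugeField (F.P K) k (Matrix.specialUnitaryGroup (Fin 2) ℂ)),
      PlaqSmall (eps1Of (T3Scales F γ hγ (hγ1.trans (sq_min_one_le _ 𝔠.gamma0_pos)) K) 𝔠.lane.carrier k) V →
        ∃ w : GaugeTransf (F.P K) 0 (Matrix.specialUnitaryGroup (Fin 2) ℂ), ukAll q.X.Uk k (gaugeAct u V) = gaugeAct w (ukAll q.X.Uk k V) :=
  q.hcov_of_thm1UniqueMinOrbitAt ha₁ (AlphaInputsT3AC.thm1UniqueMinOrbitAt_of_prop7 𝔠.B₃_pos h7 q.a₁) k hk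

/-- ★ **THE LOWER ROW AT THE T³ RECORD ON PRINT'S FAMILY, r1′ READ FROM THE NAMED SCHEMA** — ✓p777817 ★`fibre57LowOnAC_T3_loPrintAC_of_le_gamma_of_uniqueMinOrbit` VERBATIM except
`huniq ↦ (hT : Thm1UniqueMinOrbitAt F.L q.a₀ q.a₁ 𝔠.B₃)`.  Displayed after this edition: charts, Gaussian datum, `hinv`, the (55)∕(58) pins of `q.𝔖` at `triv`, `hγs`, `ha₁`, `hT`
(the `L`-level [7] Thm 1 uniqueness schema, sibling of `Thm1GlobalMinAt`), `hdom` (E2). [cite: Balaban1985UV3, (37) p.265 + (47) p.267 + (55)–(58) pp.269–270 + p.272 L32–33; Balaban1985Variational, Thm 1 (8) p.279] -/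
theorem fibre57LowOnAC_T3_loPrintAC_of_le_gamma_of_thm1UniqueMinOrbitAt (hγs : γ ≤ ((((4500 : ℝ) * (F.L : ℝ) ^ 5)⁻¹ / (𝔠.b₀ * Q0 𝔠.p₀)) ^ 2) ^ 2)
    (ha₁ : ∀ i, θBal F.L γ 𝔠.b₀ 𝔠.p₀ i ≤ q.a₁) (hT : Thm1UniqueMinOrbitAt F.L q.a₀ q.a₁ 𝔠.B₃)
    (k : ℕ) (hk : k + 1 ≤ K)
    (Φ : GaugeField (F.P K) (k + 1) (Matrix.specialUnitaryGroup (Fin 2) ℂ) × GaugeField (F.P K) k (Matrix.specialUnitaryGroup (Fin 2) ℂ) →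
      GaugeField (F.P K) k (Matrix.specialUnitaryGroup (Fin 2) ℂ))
    (J : GaugeField (F.P K) (k + 1) (Matrix.specialUnitaryGroup (Fin 2) ℂ) × GaugeField (F.P K) k (Matrix.specialUnitaryGroup (Fin 2) ℂ) → ℝ≥0)
    (T : Set (GaugeField (F.P K) (k + 1) (Matrix.specialUnitaryGroup (Fin 2) ℂ) × GaugeField (F.P K) k (Matrix.specialUnitaryGroup (Fin 2) ℂ)))
    (hΦ : Measurable Φ) (hJ : Measurable J) (hT' : MeasurableSet T)
    (hmap : ((((fieldMeasure (F.P K) (k + 1) (Matrix.specialUnitaryGroup (Fin 2) ℂ)).prod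
        (fieldMeasure (F.P K) k (Matrix.specialUnitaryGroup (Fin 2) ℂ))).restrict T).withDensity (fun z => (J z : ℝ≥0∞))).map Φ =
      (fieldMeasure (F.P K) k (Matrix.specialUnitaryGroup (Fin 2) ℂ)).restrict
        {U : GaugeField (F.P K) k (Matrix.specialUnitaryGroup (Fin 2) ℂ) |
          ∀ c i, dist1 (loopHol U c i) < ((Fintype.card (Idx (F.P K)) : ℝ))⁻¹ / 10})
    (hfib : ∀ z ∈ T, avgFun (expMeanLogSU (n := Fin 2)) (Φ z) = z.1) (N lσ dg : ℝ)
    (q_1 : GaugeField (F.P K) (k + 1) (Matrix.specialUnitaryGroup (Fin 2) ℂ) → GaugeField (F.P K) k (Matrix.specialUnitaryGroup (Fin 2) ℂ) → ℝ)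
    (hqm : ∀ V, Measurable (q_1 V)) (hZ : ∀ V, 0 < partZ (fieldMeasure (F.P K) k (Matrix.specialUnitaryGroup (Fin 2) ℂ)) (q_1 V))
    (hinv : GaugeInvariant (fun U : GaugeField (F.P K) k (Matrix.specialUnitaryGroup (Fin 2) ℂ) =>
      Real.exp (-((towerOfAC 𝔠.lane q.X q.𝔖).mainT k (Hist.triv (F.P K) k) U) + (towerOfAC 𝔠.lane q.X q.𝔖).Pint k (Hist.triv (F.P K) k) U)))
    (hdom : ∀ U : GaugeField (F.P K) k (Matrix.specialUnitaryGroup (Fin 2) ℂ),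
      chiB 𝔠.lane.carrier.M₁ (rcolOf (T3Scales F γ hγ (hγ1.trans (sq_min_one_le _ 𝔠.gamma0_pos)) K) 𝔠.lane.carrier) (eps1Of (T3Scales F γ hγ (hγ1.trans (sq_min_one_le _ 𝔠.gamma0_pos)) K) 𝔠.lane.carrier) k (Hist.triv (F.P K) (k + 1)) U ≠ 0 → U ∈ PinnedStep.loPrintAC 𝔠.lane q.X k)
    (hσ : (piecesAC 𝔠.lane q.X q.𝔖 k).logσ₀ = lσ) (hdg : (piecesAC 𝔠.lane q.X q.𝔖 k).dg = dg)
    (hstar : (piecesAC 𝔠.lane q.X q.𝔖 k).starB (Hist.triv (F.P K) (k + 1)) = N)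
    (hZU : ∀ V, (piecesAC 𝔠.lane q.X q.𝔖 k).logZU (Hist.triv (F.P K) (k + 1)) V =
      Real.log (partZ (fieldMeasure (F.P K) k (Matrix.specialUnitaryGroup (Fin 2) ℂ)) (q_1 V)))
    (hFl : ∀ V, (piecesAC 𝔠.lane q.X q.𝔖 k).logFl (Hist.triv (F.P K) (k + 1)) V =
      Real.log (∫ U', (Real.exp (-((lσ + dg * Real.log ((T3Scales F γ hγ (hγ1.trans (sq_min_one_le _ 𝔠.gamma0_pos)) K).gk k)) * N)) * T.indicator (fun z => (J z : ℝ)) (V, U')) *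
              chiB 𝔠.lane.carrier.M₁ (rcolOf (T3Scales F γ hγ (hγ1.trans (sq_min_one_le _ 𝔠.gamma0_pos)) K) 𝔠.lane.carrier) (eps1Of (T3Scales F γ hγ (hγ1.trans (sq_min_one_le _ 𝔠.gamma0_pos)) K) 𝔠.lane.carrier) k
                (Hist.triv (F.P K) (k + 1)) (Φ (V, U')) *
              Real.exp (-((towerOfAC 𝔠.lane q.X q.𝔖).mainT k (Hist.triv (F.P K) k) (Φ (V, U')) -
                    (towerOfAC 𝔠.lane q.X q.𝔖).mainT (k + 1) (Hist.triv (F.P K) (k + 1)) V)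
                + ((towerOfAC 𝔠.lane q.X q.𝔖).Pint k (Hist.triv (F.P K) k) (Φ (V, U')) - (piecesAC 𝔠.lane q.X q.𝔖 k).Pold (Hist.triv (F.P K) (k + 1)) V)
                + q_1 V U')
            ∂(normalized (fieldMeasure (F.P K) k (Matrix.specialUnitaryGroup (Fin 2) ℂ)) (q_1 V)))) :
    Fibre57LowOnAC 𝔠.lane q.X q.𝔖 (PinnedStep.loPrintAC 𝔠.lane q.X) k :=
  q.fibre57LowOnAC_T3_loPrintAC_of_le_gamma_of_uniqueMinOrbit hγs ha₁ (q.huniq_of_thm1UniqueMinOrbitAt hT) k hk Φ J T hΦ hJ hT' hmap hfib N lσ dg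
    q_1 hqm hZ hinv hdom hσ hdg hstar hZU hFl

end AlphaInputsT3AC.PkgCoreRows

end Summit.QuantumFields.YangMills.Theorems

end
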